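import Summits.KontsevichZagierPeriods.KontsevichZagierPeriods.Theorems.MzvKernelInKZTwoPosetsFurushoBridge
import Literature.NumberTheory.Transcendental.KZRulesAssociator
import Literature.NumberTheory.Transcendental.MZVWordShuffleProofs

/-!
# `MzvKernelInKZ` (stmt-KontsevichZagierPeriods-3914), line two-posets-interior-landen: converse bridges to route `FurushoPentagon`

The sibling file `MzvKernelInKZTwoPosetsFurushoBridge` derives this line's product statements
`StuffleProductInKZ` and `ShuffleProductInKZ` (stuffle and shuffle of the canonical word
representations `[Δ_N, ω_ε]` of NON-EMPTY admissible indices) from the items `StuffleInKZ`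
(stmt-3931) and `ShuffleIsDissection` (stmt-3932) of route `FurushoPentagon`, which are stated for
ALL admissible indices over any assignment `Z` pinned to the classes of Kontsevich's simplex
representations `KZ.mzvRep`. This file proves the two converse bridges (registered sub-goals
`stub_stuffleInKZOfLine`, `stub_shuffleIsDissectionOfLine` of the lead's skeleton), so the line's
move chains also close those two items.

For non-empty indices the statements agree term by term: a pinned `Z` coincides with the bracket
`zIdx · 1` on admissible indices (`zIdx_one_eq_of_mzvRep`: the canonical word representation of an
index IS `KZ.mzvRep`), the word of an index read in its weight is its binary word, and each shuffle
`w ∈ ε(s) ш ε(t)` is the binary word of the admissible index `MZV.ofBinaryWord w`. The only extra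
content is the empty index: `KZ.mzvRep []` is the point representation `[pt, 1]`
(`KZ.mzvRep_nil`), whose class is a two-sided unit of the Fubini product modulo relations
(`KZ.of_unit_mul_sub_mem_relations`, `KZ.mul_of_unit_sub_mem_relations`: the product with the
point is a coordinate relabelling, one change-of-variables move), while `[] ∗ t = [t]`,
`s ∗ [] = [s]`, `[] ш v = [v]`, `u ш [] = [u]`.

Sources: M. E. Hoffman, *The algebra of multiple harmonic series*, J. Algebra 194 (1997), §2;
M. Eie, *The theory of multiple zeta values with applications in combinatorics* (2013), §1.2;
M. Kontsevich, D. Zagier, *Periods* (2001), §§1.1–1.2 and §4.1 (periods form a ring).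
-/

noncomputable section

namespace Summit.KontsevichZagierPeriods.MzvKernelInKZ.TwoPosets

open Set MeasureTheory
open Literature.NumberTheory.Transcendental
open Summit.KontsevichZagierPeriods.MzvKernelInKZ.Negative
open Summit.KontsevichZagierPeriods.KontsevichZagierPeriods.Theses.FurushoPentagon
  (StuffleInKZ ShuffleIsDissection)

/-! ## Pinned assignments: the empty index is the unit, the others are brackets -/

section Pinned

variable {Z : List ℕ → KZ.FormalRep}

/-- An assignment pinned to Kontsevich's simplex classes sends the empty index to the class of
the point representation `[pt, 1]` (`KZ.mzvRep_nil`). -/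
theorem pinned_nil
    (hZ : ∀ (u : List ℕ) (hu : MZV.IsAdmissible u), Z u = KZ.of (KZ.mzvRep u hu
      (KZ.mzvIntegrand_isSemialgebraicFunOn_holds u) (KZ.mzvIntegrand_integrableOn_holds u hu))) :
    Z [] = KZ.of KZ.IntegralRep.unit := by
  rw [hZ [] MZV.isAdmissible_nil, KZ.mzvRep_nil]
  rfl

/-- Left unit law for a pinned assignment: `Z [] · c − c` is a relation (the product with the
point representation is a coordinate relabelling of each generator, Kontsevich–Zagier §4.1). -/
theorem pinned_nil_mul_sub_mem_relations
    (hZ : ∀ (u : List ℕ) (hu : MZV.IsAdmissible u), Z u = KZ.of (KZ.mzvRep u hu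
      (KZ.mzvIntegrand_isSemialgebraicFunOn_holds u) (KZ.mzvIntegrand_integrableOn_holds u hu)))
    (c : KZ.FormalRep) : Z [] * c - c ∈ KZ.relations := by
  rw [pinned_nil hZ]
  exact KZ.of_unit_mul_sub_mem_relations c

/-- Right unit law for a pinned assignment: `c · Z [] − c` is a relation. -/
theorem pinned_mul_nil_sub_mem_relations
    (hZ : ∀ (u : List ℕ) (hu : MZV.IsAdmissible u), Z u = KZ.of (KZ.mzvRep u hu
      (KZ.mzvIntegrand_isSemialgebraicFunOn_holds u) (KZ.mzvIntegrand_integrableOn_holds u hu)))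
    (c : KZ.FormalRep) : c * Z [] - c ∈ KZ.relations := by
  rw [pinned_nil hZ]
  exact KZ.mul_of_unit_sub_mem_relations c

/-- A pinned assignment agrees with the bracket `zIdx · 1` on admissible indices (the canonical
word representation of an admissible index is `KZ.mzvRep`, `zIdx_one_eq_of_mzvRep`). -/
theorem pinned_eq_zIdx
    (hZ : ∀ (u : List ℕ) (hu : MZV.IsAdmissible u), Z u = KZ.of (KZ.mzvRep u hu
      (KZ.mzvIntegrand_isSemialgebraicFunOn_holds u) (KZ.mzvIntegrand_integrableOn_holds u hu)))
    {u : List ℕ} (hu : MZV.IsAdmissible u) : Z u = zIdx u 1 := by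
  rw [hZ u hu, zIdx_one_eq_of_mzvRep u hu]

end Pinned

/-! ## Index bookkeeping -/

/-- A non-empty admissible index has positive weight (its first entry is at least `2`). -/
theorem weight_pos_of_ne_nil {s : List ℕ} (hs : MZV.IsAdmissible s) (hs0 : s ≠ []) :
    0 < MZV.weight s := by
  obtain ⟨a, s', rfl⟩ := List.exists_cons_of_ne_nil hs0
  have := hs.2 (List.cons_ne_nil a s')
  simp only [MZV.weight, List.sum_cons, List.head_cons] at this ⊢
  omega

/-- A shuffle of the binary words of two admissible indices, read as an index, is admissible
(it begins with the first letter of one of the two words, which is not `1`,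
`MZV.head?_binaryWord_ne_some_true`). -/
theorem isAdmissible_ofBinaryWord_of_mem_shuffleWord {s t : List ℕ} (hs : MZV.IsAdmissible s)
    (ht : MZV.IsAdmissible t) {w : List Bool}
    (hw : w ∈ MZV.shuffleWord (MZV.binaryWord s) (MZV.binaryWord t)) :
    MZV.IsAdmissible (MZV.ofBinaryWord w) := by
  refine MZV.isAdmissible_ofBinaryWord ?_
  rcases MZV.head?_of_mem_shuffleWord _ _ hw with h | h <;> rw [h]
  exacts [MZV.head?_binaryWord_ne_some_true hs, MZV.head?_binaryWord_ne_some_true ht]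

/-! ## The converse bridges (registered sub-goals) -/

/-- **Bridge**: the stuffle product on the canonical word representations of non-empty admissible
indices (`StuffleProductInKZ`) gives route `FurushoPentagon`'s crux `StuffleInKZ` (stmt-3931):
for non-empty `s`, `t` the two statements coincide under `Z u = zIdx u 1`; for `s = []` or
`t = []` the stuffle is `[t]`, resp. `[s]` (Hoffman's rule (A1)) and the defect is the unit law
of the point representation modulo relations. -/
theorem stub_stuffleInKZOfLine : StuffleProductInKZ → StuffleInKZ := by
  intro hSt Z hZ s t hs ht
  rcases eq_or_ne s [] with rfl | hs0
  · rw [MZV.stuffle_nil_left, List.map_singleton, List.sum_singleton]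
    exact pinned_nil_mul_sub_mem_relations hZ (Z t)
  rcases eq_or_ne t [] with rfl | ht0
  · rw [MZV.stuffle_nil_right, List.map_singleton, List.sum_singleton]
    exact pinned_mul_nil_sub_mem_relations hZ (Z s)
  have h := hSt s t hs ht hs0 ht0
  have hterms : ((MZV.stuffle s t).map fun u => zIdx u 1) = (MZV.stuffle s t).map Z :=
    List.map_congr_left fun u hu =>
      (pinned_eq_zIdx hZ (MZV.isAdmissible_of_mem_stuffle hs ht hu)).symm
  rwa [← pinned_eq_zIdx hZ hs, ← pinned_eq_zIdx hZ ht, hterms] at h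

/-- **Bridge**: the shuffle product on the canonical word representations of admissible words of
positive lengths (`ShuffleProductInKZ`) gives route `FurushoPentagon`'s support item
`ShuffleIsDissection` (stmt-3932): for non-empty `s`, `t` take the binary words of `s` and `t`
read in their weights (`adm_bword`, `ofFn_wordOf`) and identify each shuffle term with the class
of the index `MZV.ofBinaryWord w` (`zIdx_ofBinaryWord_of_mem_shuffleWord`); for `s = []` or
`t = []` the shuffle is the single word `ε(t)`, resp. `ε(s)`, read back as `t`, resp. `s`
(`MZV.ofBinaryWord_binaryWord`), and the defect is the unit law of the point representation. -/
theorem stub_shuffleIsDissectionOfLine : ShuffleProductInKZ → ShuffleIsDissection := by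
  intro hSh Z hZ s t hs ht
  rcases eq_or_ne s [] with rfl | hs0
  · rw [show MZV.binaryWord [] = [] from rfl, MZV.shuffleWord_nil_left, List.map_singleton,
      List.sum_singleton, MZV.ofBinaryWord_binaryWord ht.1]
    exact pinned_nil_mul_sub_mem_relations hZ (Z t)
  rcases eq_or_ne t [] with rfl | ht0
  · rw [show MZV.binaryWord [] = [] from rfl, MZV.shuffleWord_nil_right, List.map_singleton,
      List.sum_singleton, MZV.ofBinaryWord_binaryWord hs.1]
    exact pinned_mul_nil_sub_mem_relations hZ (Z s)
  have h := hSh (MZV.weight s) (MZV.weight t) (bword _ s) (bword _ t) (adm_bword hs) (adm_bword ht)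
    (weight_pos_of_ne_nil hs hs0) (weight_pos_of_ne_nil ht ht0)
  have e1 : List.ofFn (bword (MZV.weight s) s) = MZV.binaryWord s := ofFn_wordOf hs.length_binaryWord
  have e2 : List.ofFn (bword (MZV.weight t) t) = MZV.binaryWord t := ofFn_wordOf ht.length_binaryWord
  rw [e1, e2, ← zIdx_of_adm hs, ← zIdx_of_adm ht, ← pinned_eq_zIdx hZ hs, ← pinned_eq_zIdx hZ ht]
    at h
  have hterms : ((MZV.shuffleWord (MZV.binaryWord s) (MZV.binaryWord t)).map fun w =>
      zWord (MZV.weight s + MZV.weight t) (wordOf (MZV.weight s + MZV.weight t) w) 1) =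
      (MZV.shuffleWord (MZV.binaryWord s) (MZV.binaryWord t)).map fun w =>
        Z (MZV.ofBinaryWord w) :=
    List.map_congr_left fun w hw => by
      rw [← zIdx_ofBinaryWord_of_mem_shuffleWord hs ht hs0 ht0 hw,
        pinned_eq_zIdx hZ (isAdmissible_ofBinaryWord_of_mem_shuffleWord hs ht hw)]
  rwa [hterms] at h

end Summit.KontsevichZagierPeriods.MzvKernelInKZ.TwoPosets
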